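import Mathlib.Data.Finset.Prod
import Mathlib.Data.Fintype.Basic
import Mathlib.Tactic.Group
import Summits.MatrixMultiplication.OmegaCensus.ProductBoxBound

/-!
# ω-census, family (b3): independent cell sets in boxes — the bound predicate `BoxOK` and its symmetries (any group)

HONEST FRAMING (pub-omega census; verbatim): lottery ticket; floor = certified bounds/negative ranges.
Census BOOKKEEPING machinery for the box bound of `ProductBoxBound.lean`; no value of `ω` is touched here.

`BoxOK k X Y W` says: every set of cells inside `X × Y × W ⊆ G³` without an interacting ordered pair (`cellWord P P' ≠ 1`
for `P ≠ P'`, `ProductBoxBound.cellWord`) has at most `k` elements — literally the hypothesis of `box_bound`.  This file proves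
that the predicate passes to sub-boxes (`BoxOK.mono`) and is pulled back along the four symmetries used to normalise boxes
(`BoxOK.of_map` and its instances): right translation of the second or third coordinate (`of_mulY`, `of_mulW`: the cell word
is unchanged), simultaneous conjugation (`of_conj`: the word is conjugated) and the swap `(x, y, w) ↦ (x, w, y)` (`of_swap`:
a trivial word of the images is a trivial word of the originals in the opposite order — rotate and invert).  The `S₃`
instance (`α_{S₃}(6,3,3) ≤ 10`) is `S3BoxData.lean` + `S3BoxIndependence.lean`.
-/

open Finset
open Summit.MatrixMultiplication.OmegaCensus.ProductBoxBound

namespace Summit.MatrixMultiplication.OmegaCensus.BoxIndep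

/-! ## Boxes and their symmetries (any group) -/

section AnyGroup

variable {G : Type*} [Group G]

/-- `BoxOK k X Y W`: every independent set of cells inside the box `X × Y × W` has at most `k` elements — exactly the
hypothesis of `ProductBoxBound.box_bound`. [folklore] -/
def BoxOK (k : ℕ) (X Y W : Finset G) : Prop :=
  ∀ I : Finset (G × G × G), I ⊆ X ×ˢ (Y ×ˢ W) → (∀ P ∈ I, ∀ P' ∈ I, P ≠ P' → cellWord P P' ≠ 1) → I.card ≤ k

/-- Smaller boxes inherit the bound. [folklore] -/
theorem BoxOK.mono {k : ℕ} {X Y W X' Y' W' : Finset G} (h : BoxOK k X Y W) (hX : X' ⊆ X) (hY : Y' ⊆ Y) (hW : W' ⊆ W) :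
    BoxOK k X' Y' W' := fun I hI hind =>
  h I (hI.trans (product_subset_product hX (product_subset_product hY hW))) hind

/-- Transport: an injective map of cells that sends the box `X × Y × W` into `X' × Y' × W'` and under which a trivial cell word
of two images forces a trivial cell word of the originals (in one of the two orders) pulls the bound back. [folklore] -/
theorem BoxOK.of_map [DecidableEq G] {k : ℕ} {X Y W X' Y' W' : Finset G} (φ : G × G × G → G × G × G) (hφ : Function.Injective φ)
    (hbox : ∀ P ∈ X ×ˢ (Y ×ˢ W), φ P ∈ X' ×ˢ (Y' ×ˢ W'))
    (hw : ∀ P P', cellWord (φ P) (φ P') = 1 → cellWord P P' = 1 ∨ cellWord P' P = 1) (h : BoxOK k X' Y' W') :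
    BoxOK k X Y W := by
  intro I hI hind
  rw [← card_image_of_injective I hφ]
  refine h (I.image φ) (fun R hR => ?_) fun R hR R' hR' hne hRR' => ?_
  · obtain ⟨P, hP, rfl⟩ := mem_image.1 hR
    exact hbox P (hI hP)
  · obtain ⟨P, hP, rfl⟩ := mem_image.1 hR
    obtain ⟨P', hP', rfl⟩ := mem_image.1 hR'
    have hPP' : P ≠ P' := fun e => hne (by rw [e])
    rcases hw P P' hRR' with h1 | h1
    · exact hind P hP P' hP' hPP' h1
    · exact hind P' hP' P hP hPP'.symm h1

/-- Right translation of the second coordinate: `cellWord` is unchanged. [folklore] -/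
theorem BoxOK.of_mulY [Fintype G] [DecidableEq G] {k : ℕ} {Y W : Finset G} (g : G) (h : BoxOK k univ (Y.image (· * g)) W) : BoxOK k univ Y W := by
  refine BoxOK.of_map (fun P => (P.1, P.2.1 * g, P.2.2)) ?_ ?_ ?_ h
  · rintro ⟨x, y, w⟩ ⟨x', y', w'⟩ e
    simp only [Prod.mk.injEq, mul_left_inj] at e
    obtain ⟨rfl, rfl, rfl⟩ := e; rfl
  · rintro ⟨x, y, w⟩ hP
    simp only [mem_product, mem_univ, true_and, mem_image] at hP ⊢
    exact ⟨⟨y, hP.1, rfl⟩, hP.2⟩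
  · rintro ⟨x, y, w⟩ ⟨x', y', w'⟩ h1
    left
    simp only [cellWord] at h1 ⊢
    rw [← h1]; group

/-- Right translation of the third coordinate. [folklore] -/
theorem BoxOK.of_mulW [Fintype G] [DecidableEq G] {k : ℕ} {Y W : Finset G} (g : G) (h : BoxOK k univ Y (W.image (· * g))) : BoxOK k univ Y W := by
  refine BoxOK.of_map (fun P => (P.1, P.2.1, P.2.2 * g)) ?_ ?_ ?_ h
  · rintro ⟨x, y, w⟩ ⟨x', y', w'⟩ e
    simp only [Prod.mk.injEq, mul_left_inj] at e
    obtain ⟨rfl, rfl, rfl⟩ := e; rfl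
  · rintro ⟨x, y, w⟩ hP
    simp only [mem_product, mem_univ, true_and, mem_image] at hP ⊢
    exact ⟨hP.1, ⟨w, hP.2, rfl⟩⟩
  · rintro ⟨x, y, w⟩ ⟨x', y', w'⟩ h1
    left
    simp only [cellWord] at h1 ⊢
    rw [← h1]; group

/-- Simultaneous conjugation: `cellWord` is conjugated. [folklore] -/
theorem BoxOK.of_conj [Fintype G] [DecidableEq G] {k : ℕ} {Y W : Finset G} (c : G)
    (h : BoxOK k univ (Y.image fun y => c * y * c⁻¹) (W.image fun w => c * w * c⁻¹)) : BoxOK k univ Y W := by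
  refine BoxOK.of_map (fun P => (c * P.1 * c⁻¹, c * P.2.1 * c⁻¹, c * P.2.2 * c⁻¹)) ?_ ?_ ?_ h
  · rintro ⟨x, y, w⟩ ⟨x', y', w'⟩ e
    simp only [Prod.mk.injEq, mul_left_inj, mul_right_inj] at e
    obtain ⟨rfl, rfl, rfl⟩ := e; rfl
  · rintro ⟨x, y, w⟩ hP
    simp only [mem_product, mem_univ, true_and, mem_image] at hP ⊢
    exact ⟨⟨y, hP.1, rfl⟩, ⟨w, hP.2, rfl⟩⟩
  · rintro ⟨x, y, w⟩ ⟨x', y', w'⟩ h1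
    left
    simp only [cellWord] at h1 ⊢
    have h2 : c⁻¹ * (c * x * c⁻¹ * (c * x' * c⁻¹)⁻¹ * (c * y * c⁻¹ * (c * y' * c⁻¹)⁻¹) *
        (c * w * c⁻¹ * (c * w' * c⁻¹)⁻¹)) * c = 1 := by rw [h1]; group
    rw [← h2]; group

/-- The swap `(x, y, w) ↦ (x, w, y)`: a trivial cell word of the images is a trivial cell word of the originals in the
opposite order (cyclic rotation and inversion of the word). [folklore] -/
theorem BoxOK.of_swap [Fintype G] [DecidableEq G] {k : ℕ} {Y W : Finset G} (h : BoxOK k univ W Y) : BoxOK k univ Y W := by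
  refine BoxOK.of_map (fun P => (P.1, P.2.2, P.2.1)) ?_ ?_ ?_ h
  · rintro ⟨x, y, w⟩ ⟨x', y', w'⟩ e
    simp only [Prod.mk.injEq] at e
    obtain ⟨rfl, rfl, rfl⟩ := e; rfl
  · rintro ⟨x, y, w⟩ hP
    simp only [mem_product, mem_univ, true_and] at hP ⊢
    exact ⟨hP.2, hP.1⟩
  · rintro ⟨x, y, w⟩ ⟨x', y', w'⟩ h1
    right
    simp only [cellWord] at h1 ⊢
    -- `h1 : x x'⁻¹ (w w'⁻¹) (y y'⁻¹) = 1`; rotate to `(w w'⁻¹)(y y'⁻¹)(x x'⁻¹) = 1` and invert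
    have h2 : w * w'⁻¹ * (y * y'⁻¹) * (x * x'⁻¹) = 1 :=
      mul_eq_one_comm.mp (show x * x'⁻¹ * (w * w'⁻¹ * (y * y'⁻¹)) = 1 by rw [← h1]; group)
    rw [← inv_eq_one, ← h2]; group

end AnyGroup

end Summit.MatrixMultiplication.OmegaCensus.BoxIndep
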